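import Mathlib.Analysis.Real.Pi.Bounds
import Literature.Probability.LatticeModels.PlaneRotatorWiredEnergyCeiling
import Literature.Probability.LatticeModels.GinibreBesselBounds
import HarnessLib

/-!
# The wired two-spin energy in the dual variables and the certified decimal
# `(6/7)·E^{wired}_3(6/7) < 2/π`: the Kosterlitz–Thouless reading `T_c ≤ (7/6)·J` of the wired ceiling

Topic `Literature/Probability/LatticeModels`; companion of `PlaneRotatorWiredEnergyCeiling.lean`, which proves
for the plane rotator on `(ℤ/Lℤ)²` (`L ≥ 3`, `K ≥ 0`) the volume-uniform ceilings `E_L(K) ≤ E^{wired}_3(K)` and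
`βΥ_L(K) ≤ K·E^{wired}_3(K)`, with `E^{wired}_m(K) = wiredPairEnergy K m` the Ginibre expectation
`⟨cos(θ₁ − θ₀)⟩` of two rotators coupled with strength `K` to each other and `m·K` each to a frozen ghost, and
reduces the K2-conditional Kosterlitz–Thouless reading to ONE certified inequality
`K₀·E^{wired}_3(K₀) < 2/π` (`kt_le_of_stableBelow_of_wiredCeiling`). This file supplies it at `K₀ = 6/7`:

* §1–§2 **two-sided rational enclosures of `I_m(x)`** from the power series
  (`sum_besselITerm_le_besselI`: partial sums from below; `besselI_le_sum_add_tail`: partial sum plus a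
  geometric tail `t_N/(1 − q)` from above, `(x/2)² ≤ q(N+1)(N+1+|m|)`);
* §3 **the dual (integer-current) form of the wired pair** (character expansion of the three-bond Ginibre model
  on `U(1)²`, tree `ginibreExpect_reChar_eq_tsum_div_tsum`): the closed currents are `(k, k, −k)`
  (`twistChar_wiredPair_one_eq_one_iff`) and, with the bond source, `(k, k+1, −(k+1))`
  (`twistChar_wiredPair_zero_eq_one_iff`), whence
  **`wiredPairEnergy_eq_tsum_div_tsum`: `E^{wired}_m(K) = ∑_{k∈ℤ} I_k(K)I_{k+1}(mK)² / ∑_{k∈ℤ} I_k(K)I_k(mK)²`**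
  (`wiredPair_num_eq_tsum`, `wiredPair_den_eq_tsum`, `summable_wiredPair_num/den`);
* §4 **the certified decimal** (`K₀ = 6/7`, `m = 3`; exact rational arithmetic, cell
  `pub/hubbard-tc/hubbard-tc-p1/tools/wired_cert_literals.py`, every literal re-checked here by `norm_num` on
  eight-term partial sums): `D ≥ 21.5423` (five central dual terms), `N ≤ 15.9273` (ten dual terms and the
  factorial tail `2 I_0(6/7) I_0(18/7)² ∑_{j≥5}(3/7)^j/j! ≤ 0.0038`), so
  **`six_sevenths_mul_wiredPairEnergy_lt`: `(6/7)·E^{wired}_3(6/7) < 2/π`** (`0.6337 < 0.63662`);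
* §5 the readings: **`kt_le_seven_sixths_of_stableBelow_of_wiredCeiling`**,
  **`kt_le_seven_sixths_of_stableBelow_of_tendsto_torusXYStiffness`** — under the Kosterlitz–Thouless
  stability HYPOTHESIS `StableBelow ρ T_c` and `ρ(T) = lim_n T·βΥ_{L_n}(J/T)` (tori, `L_n ≥ 3`):
  **`T_c ≤ (7/6)·J ≈ 1.1667·J`** (was `1.3448·J` from the Ward energy ceiling, `(π/2)·J` bare; float optimum of
  the wired route `1.1624·J`; Monte Carlo `0.893·J` [floats, not used]); and the hypothesis-free finite-volume
  fact `torusXYStiffness_six_sevenths_lt`: **`βΥ_L(6/7) < 2/π` for every `L ≥ 3`**.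

WHAT THIS IS NOT: a statement about the Hubbard model or any material; no number of record of the `hubbard-tc`
cell moves; `StableBelow` (K2) stays a NAMED HYPOTHESIS; classical comparison model only.

## References

* J. Ginibre, Comm. Math. Phys. 16 (1970) 310–328, Model 3 p. 322 (plane rotators). [Ginibre1970]
* J. Fröhlich, T. Spencer, Comm. Math. Phys. 83 (1982) 411–454, §2.3 (duality transformation / integer
  currents). [FrohlichSpencerCMP1982]
* I. Montvay, G. Münster, *Quantum Fields on a Lattice* (1994), §3.2.7 (3.169)–(3.172). [MontvayMunster1994]
* M. Abramowitz, I. A. Stegun, *Handbook of Mathematical Functions* (1964), 9.6.6, 9.6.10. [AbramowitzStegun1964]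
* D. R. Nelson, *Defects and Geometry in Condensed Matter Physics* (2002), §2.2.2 (2.44)–(2.47).
  [Nelson2002Defects]
* M. E. Fisher, M. N. Barber, D. Jasnow, Phys. Rev. A 8 (1973) 1111, §II. [FisherBarberJasnow1973]
-/

noncomputable section

open MeasureTheory Filter Finset
open scoped Topology BigOperators Nat

namespace Literature.Probability.LatticeModels

/-! ## §1 Geometric tails -/

/-- A non-negative sequence with ratios at most `q < 1` is summable with sum `≤ a₀/(1 − q)`.
[folklore] -/
private theorem summable_and_tsum_le_of_succ_le_mul {a : ℕ → ℝ} {q : ℝ} (h0 : ∀ k, 0 ≤ a k)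
    (hq0 : 0 ≤ q) (hq1 : q < 1) (h : ∀ k, a (k + 1) ≤ q * a k) :
    Summable a ∧ (∑' k, a k) ≤ a 0 / (1 - q) := by
  have hle : ∀ k, a k ≤ a 0 * q ^ k := by
    intro k
    induction k with
    | zero => simp
    | succ k ih =>
      calc a (k + 1) ≤ q * a k := h k
        _ ≤ q * (a 0 * q ^ k) := mul_le_mul_of_nonneg_left ih hq0
        _ = a 0 * q ^ (k + 1) := by ring
  have hg : Summable fun k => a 0 * q ^ k := (summable_geometric_of_lt_one hq0 hq1).mul_left (a 0)
  have hs : Summable a := Summable.of_nonneg_of_le h0 hle hg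
  refine ⟨hs, ?_⟩
  calc ∑' k, a k ≤ ∑' k, a 0 * q ^ k := hs.tsum_le_tsum hle hg
    _ = a 0 * (1 - q)⁻¹ := by rw [tsum_mul_left, tsum_geometric_of_lt_one hq0 hq1]
    _ = a 0 / (1 - q) := by rw [div_eq_mul_inv]

/-! ## §2 Two-sided rational enclosures of `I_m(x)` from the power series -/

/-- **Lower enclosure**: every partial sum of the (non-negative) power series is below `I_m(x)`
(`x ≥ 0`). [cite: AbramowitzStegun1964, 9.6.10 (the series defining I_ν)] -/
theorem sum_besselITerm_le_besselI {x : ℝ} (hx : 0 ≤ x) (m : ℤ) (N : ℕ) :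
    ∑ k ∈ Finset.range N, besselITerm m x k ≤ besselI m x :=
  sum_le_hasSum (Finset.range N) (fun k _ => besselITerm_nonneg hx m k) (hasSum_besselITerm m x)

/-- The ratio of consecutive terms of the Bessel series:
`t_{k+1} = t_k · (x/2)² / ((k+1)(k+1+|m|))`. [cite: AbramowitzStegun1964, 9.6.10 (the series defining I_ν)] -/
theorem besselITerm_succ_right (m : ℤ) (x : ℝ) (k : ℕ) :
    besselITerm m x (k + 1) =
      besselITerm m x k * ((x / 2) ^ 2 / ((k + 1 : ℝ) * (k + 1 + m.natAbs : ℝ))) := by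
  have h1 : ((k + 1)! : ℝ) = (k + 1 : ℝ) * (k ! : ℝ) := by
    rw [Nat.factorial_succ]; push_cast; ring
  have h2 : ((k + 1 + m.natAbs)! : ℝ) = (k + 1 + m.natAbs : ℝ) * ((k + m.natAbs)! : ℝ) := by
    rw [show k + 1 + m.natAbs = (k + m.natAbs) + 1 by ring, Nat.factorial_succ]; push_cast; ring
  have hk : (k ! : ℝ) ≠ 0 := by positivity
  have hkm : ((k + m.natAbs)! : ℝ) ≠ 0 := by positivity
  rw [besselITerm, besselITerm, h1, h2, show 2 * (k + 1) + m.natAbs = (2 * k + m.natAbs) + 2 by ring,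
    pow_add]
  field_simp

/-- **Upper enclosure**: `I_m(x) ≤ ∑_{k<N} t_k + t_N/(1 − q)` as soon as `(x/2)² ≤ q (N+1)(N+1+|m|)` with
`q < 1` — beyond the `N`-th term the series is dominated by a geometric one of ratio `q`.
[cite: AbramowitzStegun1964, 9.6.10 (the series defining I_ν)] -/
theorem besselI_le_sum_add_tail {x : ℝ} (hx : 0 ≤ x) (m : ℤ) (N : ℕ) {q : ℝ} (hq1 : q < 1)
    (hq : (x / 2) ^ 2 ≤ q * ((N + 1 : ℝ) * (N + 1 + m.natAbs))) :
    besselI m x ≤ ∑ k ∈ Finset.range N, besselITerm m x k + besselITerm m x N / (1 - q) := by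
  have hP : (0 : ℝ) < (N + 1 : ℝ) * (N + 1 + m.natAbs) := by positivity
  have hq0 : 0 ≤ q := by
    by_contra hneg
    push Not at hneg
    have : q * ((N + 1 : ℝ) * (N + 1 + m.natAbs)) < 0 := mul_neg_of_neg_of_pos hneg hP
    nlinarith [sq_nonneg (x / 2)]
  set a : ℕ → ℝ := fun k => besselITerm m x (k + N) with ha_def
  have ha0 : ∀ k, 0 ≤ a k := fun k => besselITerm_nonneg hx m (k + N)
  have ha : ∀ k, a (k + 1) ≤ q * a k := by
    intro k
    have hP' : (0 : ℝ) < ((k + N : ℕ) + 1 : ℝ) * ((k + N : ℕ) + 1 + m.natAbs) := by positivity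
    have hr : (x / 2) ^ 2 / (((k + N : ℕ) + 1 : ℝ) * ((k + N : ℕ) + 1 + m.natAbs)) ≤ q := by
      rw [div_le_iff₀ hP']
      refine hq.trans (mul_le_mul_of_nonneg_left ?_ hq0)
      push_cast
      nlinarith [Nat.cast_nonneg (α := ℝ) k, Nat.cast_nonneg (α := ℝ) N,
        Nat.cast_nonneg (α := ℝ) m.natAbs]
    simp only [ha_def]
    rw [show k + 1 + N = (k + N) + 1 by ring, besselITerm_succ_right, mul_comm q]
    exact mul_le_mul_of_nonneg_left hr (besselITerm_nonneg hx m (k + N))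
  obtain ⟨_, htail⟩ := summable_and_tsum_le_of_succ_le_mul ha0 hq0 hq1 ha
  rw [besselI, ← (summable_besselITerm m x).sum_add_tsum_nat_add N]
  have h0 : a 0 = besselITerm m x N := by simp [ha_def]
  rw [h0] at htail
  exact add_le_add le_rfl htail

/-! ## §3 The wired two-spin energy in the dual (integer-current) variables -/

section Dual

/-- The three characters of the wired pair at a configuration. [cite: Ginibre1970, Model 3 p. 322 (plane rotators with ferromagnetic pair couplings)] -/
private theorem wiredPairChar_apply (θ : Fin 2 → Circle) :
    wiredPairChar 0 θ = (θ 0)⁻¹ * θ 1 ∧ wiredPairChar 1 θ = θ 0 ∧ wiredPairChar 2 θ = θ 1 := by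
  refine ⟨?_, ?_, ?_⟩ <;> simp [wiredPairChar, pairSiteChar] <;> rfl

/-- The current monomial of the wired pair: `∏_a χ_a(θ)^{n_a} = θ₀^{n₁ − n₀} θ₁^{n₀ + n₂}`.
[cite: FrohlichSpencerCMP1982, §2.3 (duality transformation)] -/
private theorem prod_wiredPairChar_zpow (n : Fin 3 → ℤ) (θ : Fin 2 → Circle) :
    ∏ a, (wiredPairChar a θ) ^ (n a) = (θ 0) ^ (n 1 - n 0) * (θ 1) ^ (n 0 + n 2) := by
  obtain ⟨h0, h1, h2⟩ := wiredPairChar_apply θ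
  rw [Fin.prod_univ_three, h0, h1, h2, mul_zpow, inv_zpow, zpow_sub, zpow_add]
  simp only [mul_comm, mul_assoc, mul_left_comm]

/-- A power character `z ↦ z^a` of `U(1)` that is identically `1` has `a = 0` (test at `e^{iπ/a}`).
[folklore] -/
private theorem eq_zero_of_forall_zpow_eq_one {a : ℤ} (h : ∀ z : Circle, z ^ a = 1) : a = 0 := by
  by_contra ha
  set w : Circle := Circle.exp (Real.pi / a) with hw
  have hwa : ((w ^ a : Circle) : ℂ) = -1 := by
    rw [Circle.coe_zpow, hw, Circle.coe_exp, ← Complex.exp_int_mul, ← Complex.exp_pi_mul_I]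
    congr 1
    have : (a : ℂ) ≠ 0 := by exact_mod_cast ha
    push_cast
    field_simp
  have h1 := h w
  rw [h1, Circle.coe_one] at hwa
  norm_num at hwa

/-- The monomial `θ₀^a θ₁^b` on `U(1)^{Fin 2}` is identically `1` iff `a = b = 0`. [folklore] -/
private theorem forall_zpow_mul_zpow_eq_one_iff (a b : ℤ) :
    (∀ θ : Fin 2 → Circle, (θ 0) ^ a * (θ 1) ^ b = 1) ↔ a = 0 ∧ b = 0 := by
  refine ⟨fun h => ⟨?_, ?_⟩, fun h θ => by simp [h.1, h.2]⟩
  · refine eq_zero_of_forall_zpow_eq_one fun z => ?_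
    have := h (Pi.mulSingle 0 z)
    simpa using this
  · refine eq_zero_of_forall_zpow_eq_one fun z => ?_
    have := h (Pi.mulSingle 1 z)
    simpa using this

/-- **Closed currents of the wired pair** (partition function): `∏_a χ_a^{n_a} ≡ 1` iff
`n₁ = n₀` and `n₂ = −n₀` — the current `n₀` flows around the triangle ghost → spin 0 → spin 1 → ghost.
[cite: FrohlichSpencerCMP1982, §2.3 (duality transformation: divergence-free integer currents)] -/
theorem twistChar_wiredPair_one_eq_one_iff (n : Fin 3 → ℤ) :
    twistChar wiredPairChar 1 n = 1 ↔ n 1 = n 0 ∧ n 2 = -n 0 := by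
  have key : twistChar wiredPairChar 1 n = 1 ↔
      ∀ θ : Fin 2 → Circle, (θ 0) ^ (n 1 - n 0) * (θ 1) ^ (n 0 + n 2) = 1 := by
    rw [ContinuousMonoidHom.ext_iff]
    refine forall_congr' fun θ => ?_
    rw [twistChar_apply, prod_wiredPairChar_zpow]
    simp
  rw [key, forall_zpow_mul_zpow_eq_one_iff]
  omega

/-- **Closed currents of the wired pair with the bond source**: `χ₀ ∏_a χ_a^{n_a} ≡ 1` (`χ₀` the bond
character) iff `n₁ = n₀ + 1` and `n₂ = −(n₀ + 1)`.
[cite: FrohlichSpencerCMP1982, §2.3 (duality transformation: divergence-free integer currents)] -/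
theorem twistChar_wiredPair_zero_eq_one_iff (n : Fin 3 → ℤ) :
    twistChar wiredPairChar (wiredPairChar 0) n = 1 ↔ n 1 = n 0 + 1 ∧ n 2 = -(n 0 + 1) := by
  have key : twistChar wiredPairChar (wiredPairChar 0) n = 1 ↔
      ∀ θ : Fin 2 → Circle, (θ 0) ^ (n 1 - n 0 - 1) * (θ 1) ^ (n 0 + n 2 + 1) = 1 := by
    rw [ContinuousMonoidHom.ext_iff]
    refine forall_congr' fun θ => ?_
    rw [twistChar_apply, prod_wiredPairChar_zpow, (wiredPairChar_apply θ).1]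
    have e : (θ 0)⁻¹ * θ 1 * ((θ 0) ^ (n 1 - n 0) * (θ 1) ^ (n 0 + n 2)) =
        (θ 0) ^ (n 1 - n 0 - 1) * (θ 1) ^ (n 0 + n 2 + 1) := by
      rw [zpow_sub_one, zpow_add_one]
      simp only [mul_comm, mul_assoc, mul_left_comm]
    rw [e]
    simp
  rw [key, forall_zpow_mul_zpow_eq_one_iff]
  omega

/-- The family `n ↦ ∏_a I_{n_a}(J_a)` over `ℤ^{Fin 3}` is summable (`J ≥ 0`). [cite: FrohlichSpencerCMP1982, §2.3 (duality transformation)] -/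
private theorem summable_prod_besselI_wiredPair {J : Fin 3 → ℝ} (hJ : ∀ a, 0 ≤ J a) :
    Summable fun n : Fin 3 → ℤ => ∏ a, besselI (n a) (J a) := by
  classical
  have h := summable_prod_norm (ι := Fin 3) (c := fun a k => (besselI k (J a) : ℂ))
    (fun a => summable_norm_coe_besselI (J a))
  refine h.congr fun n => Finset.prod_congr rfl fun a _ => ?_
  rw [Complex.norm_real, Real.norm_eq_abs, abs_of_nonneg (besselI_nonneg (hJ a) _)]

/-- The indicator-weighted current family is summable (`J ≥ 0`). [cite: FrohlichSpencerCMP1982, §2.3 (duality transformation)] -/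
private theorem summable_ite_prod_besselI {J : Fin 3 → ℝ} (hJ : ∀ a, 0 ≤ J a) (P : (Fin 3 → ℤ) → Prop)
    [DecidablePred P] :
    Summable fun n : Fin 3 → ℤ => if P n then ∏ a, besselI (n a) (J a) else 0 := by
  refine Summable.of_nonneg_of_le (fun n => ?_) (fun n => ?_) (summable_prod_besselI_wiredPair hJ)
  · split_ifs
    · exact Finset.prod_nonneg fun a _ => besselI_nonneg (hJ a) _
    · exact le_rfl
  · split_ifs
    · exact le_rfl
    · exact Finset.prod_nonneg fun a _ => besselI_nonneg (hJ a) _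

/-- The couplings of the wired pair are non-negative for `K ≥ 0`. [cite: Ginibre1970, Model 3 p. 322 (plane rotators with ferromagnetic pair couplings)] -/
theorem wiredPairCoupling_nonneg {K : ℝ} (hK : 0 ≤ K) (m : ℕ) (a : Fin 3) :
    0 ≤ wiredPairCoupling K m a := by
  fin_cases a <;> simp [wiredPairCoupling] <;> positivity

/-- The closed-current index `k ↦ (k, k, −k)` of the partition function. [cite: FrohlichSpencerCMP1982, §2.3 (duality transformation)] -/
private def idxD (k : ℤ) : Fin 3 → ℤ := ![k, k, -k]

/-- The closed-current index `k ↦ (k, k+1, −(k+1))` of the bond correlation. [cite: FrohlichSpencerCMP1982, §2.3 (duality transformation)] -/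
private def idxN (k : ℤ) : Fin 3 → ℤ := ![k, k + 1, -(k + 1)]

open Classical in
/-- **The partition function of the wired pair in the dual variables**:
`∑_{closed n} ∏_a I_{n_a}(J_a) = ∑_{k ∈ ℤ} I_k(K) I_k(mK)²`. [cite: FrohlichSpencerCMP1982, §2.3 (duality transformation); MontvayMunster1994 §3.2.7 (3.169)–(3.172)] -/
theorem wiredPair_den_eq_tsum {K : ℝ} (m : ℕ) :
    (∑' n : Fin 3 → ℤ, if twistChar wiredPairChar 1 n = 1 then
        ∏ a, besselI (n a) (wiredPairCoupling K m a) else 0) =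
      ∑' k : ℤ, besselI k K * besselI k (m * K) ^ 2 := by
  classical
  have hinj : Function.Injective idxD := fun k k' h => by
    have := congrFun h 0; simpa [idxD] using this
  rw [← hinj.tsum_eq (f := fun n : Fin 3 → ℤ => if twistChar wiredPairChar 1 n = 1 then
      ∏ a, besselI (n a) (wiredPairCoupling K m a) else 0)]
  · refine tsum_congr fun k => ?_
    have hk : twistChar wiredPairChar 1 (idxD k) = 1 := by
      rw [twistChar_wiredPair_one_eq_one_iff]; simp [idxD]
    simp only [hk, if_true, Fin.prod_univ_three]
    simp only [idxD, wiredPairCoupling, Matrix.cons_val_zero, Matrix.cons_val_one, Matrix.cons_val_two,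
      Matrix.head_cons, Matrix.tail_cons, besselI_neg_index]
    ring
  · intro n hn
    rw [Function.mem_support] at hn
    have hc : twistChar wiredPairChar 1 n = 1 := by
      by_contra h; exact hn (if_neg h)
    rw [twistChar_wiredPair_one_eq_one_iff] at hc
    refine ⟨n 0, funext fun a => ?_⟩
    fin_cases a <;> simp [idxD, hc.1, hc.2]

open Classical in
/-- **The bond correlation of the wired pair in the dual variables**:
`∑_{n : χ₀∏χ^{n} ≡ 1} ∏_a I_{n_a}(J_a) = ∑_{k ∈ ℤ} I_k(K) I_{k+1}(mK)²`. [cite: FrohlichSpencerCMP1982, §2.3 (duality transformation); MontvayMunster1994 §3.2.7 (3.169)–(3.172)] -/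
theorem wiredPair_num_eq_tsum {K : ℝ} (m : ℕ) :
    (∑' n : Fin 3 → ℤ, if twistChar wiredPairChar (wiredPairChar 0) n = 1 then
        ∏ a, besselI (n a) (wiredPairCoupling K m a) else 0) =
      ∑' k : ℤ, besselI k K * besselI (k + 1) (m * K) ^ 2 := by
  classical
  have hinj : Function.Injective idxN := fun k k' h => by
    have := congrFun h 0; simpa [idxN] using this
  rw [← hinj.tsum_eq (f := fun n : Fin 3 → ℤ => if twistChar wiredPairChar (wiredPairChar 0) n = 1 then
      ∏ a, besselI (n a) (wiredPairCoupling K m a) else 0)]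
  · refine tsum_congr fun k => ?_
    have hk : twistChar wiredPairChar (wiredPairChar 0) (idxN k) = 1 := by
      rw [twistChar_wiredPair_zero_eq_one_iff]; simp [idxN]
    simp only [hk, if_true, Fin.prod_univ_three]
    simp only [idxN, wiredPairCoupling, Matrix.cons_val_zero, Matrix.cons_val_one, Matrix.cons_val_two,
      Matrix.head_cons, Matrix.tail_cons, besselI_neg_index]
    ring
  · intro n hn
    rw [Function.mem_support] at hn
    have hc : twistChar wiredPairChar (wiredPairChar 0) n = 1 := by
      by_contra h; exact hn (if_neg h)
    rw [twistChar_wiredPair_zero_eq_one_iff] at hc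
    refine ⟨n 0, funext fun a => ?_⟩
    fin_cases a <;> simp [idxN, hc.1, hc.2]

/-- **The wired two-spin energy in the dual variables**:
`E^{wired}_m(K) = ∑_{k∈ℤ} I_k(K) I_{k+1}(mK)² / ∑_{k∈ℤ} I_k(K) I_k(mK)²` (character expansion of the
three-bond Ginibre model on `U(1)²`). [cite: FrohlichSpencerCMP1982, §2.3 (duality transformation); MontvayMunster1994 §3.2.7 (3.169)–(3.172)] -/
theorem wiredPairEnergy_eq_tsum_div_tsum [MeasurableSpace Circle] [BorelSpace Circle] (K : ℝ) (m : ℕ) :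
    wiredPairEnergy K m =
      (∑' k : ℤ, besselI k K * besselI (k + 1) (m * K) ^ 2) /
        ∑' k : ℤ, besselI k K * besselI k (m * K) ^ 2 := by
  classical
  rw [wiredPairEnergy, ginibreExpect_reChar_eq_tsum_div_tsum, wiredPair_num_eq_tsum, wiredPair_den_eq_tsum]

/-- Summability of the dual partition-function family `k ↦ I_k(K) I_k(mK)²` over `ℤ` (`K ≥ 0`).
[cite: FrohlichSpencerCMP1982, §2.3 (duality transformation)] -/
theorem summable_wiredPair_den {K : ℝ} (hK : 0 ≤ K) (m : ℕ) :
    Summable fun k : ℤ => besselI k K * besselI k (m * K) ^ 2 := by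
  classical
  have hinj : Function.Injective idxD := fun k k' h => by
    have := congrFun h 0; simpa [idxD] using this
  have h := (summable_ite_prod_besselI (wiredPairCoupling_nonneg hK m)
    (fun n => twistChar wiredPairChar 1 n = 1)).comp_injective hinj
  refine h.congr fun k => ?_
  have hk : twistChar wiredPairChar 1 (idxD k) = 1 := by
    rw [twistChar_wiredPair_one_eq_one_iff]; simp [idxD]
  simp only [Function.comp_apply, hk, if_true, Fin.prod_univ_three]
  simp only [idxD, wiredPairCoupling, Matrix.cons_val_zero, Matrix.cons_val_one, Matrix.cons_val_two,
    Matrix.head_cons, Matrix.tail_cons, besselI_neg_index]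
  ring

/-- Summability of the dual correlation family `k ↦ I_k(K) I_{k+1}(mK)²` over `ℤ` (`K ≥ 0`).
[cite: FrohlichSpencerCMP1982, §2.3 (duality transformation)] -/
theorem summable_wiredPair_num {K : ℝ} (hK : 0 ≤ K) (m : ℕ) :
    Summable fun k : ℤ => besselI k K * besselI (k + 1) (m * K) ^ 2 := by
  classical
  have hinj : Function.Injective idxN := fun k k' h => by
    have := congrFun h 0; simpa [idxN] using this
  have h := (summable_ite_prod_besselI (wiredPairCoupling_nonneg hK m)
    (fun n => twistChar wiredPairChar (wiredPairChar 0) n = 1)).comp_injective hinj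
  refine h.congr fun k => ?_
  have hk : twistChar wiredPairChar (wiredPairChar 0) (idxN k) = 1 := by
    rw [twistChar_wiredPair_zero_eq_one_iff]; simp [idxN]
  simp only [Function.comp_apply, hk, if_true, Fin.prod_univ_three]
  simp only [idxN, wiredPairCoupling, Matrix.cons_val_zero, Matrix.cons_val_one, Matrix.cons_val_two,
    Matrix.head_cons, Matrix.tail_cons, besselI_neg_index]
  ring

end Dual


/-! ## §4 The certified decimal at `K₀ = 6/7`, `m = 3`

Rational enclosures of `I_j(6/7)` (`j ≤ 5`) and `I_j(18/7)` (`j ≤ 5`) from eight terms of the power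
series (`sum_besselITerm_le_besselI`, `besselI_le_sum_add_tail`), produced by exact rational arithmetic
(cell `pub/hubbard-tc/hubbard-tc-p1/tools/wired_cert_literals.py`) and CHECKED here by `norm_num`; then
`D ≥ 21.5423` from the five central dual terms and `N ≤ 15.9273` from ten dual terms plus a factorial
tail, whence `(6/7)·N/D ≤ 0.63373 < 2/3.1416 < 2/π`. -/

section Decimal

/-! ### Enclosures of the Bessel values (private; `norm_num` on eight-term partial sums) -/

/-- Enclosure `I₀(6/7) ≥ 1.1922815`. [cite: AbramowitzStegun1964, 9.6.10 (the series defining I_ν, summed exactly in ℚ)] -/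
private theorem I0a_lo : (2384563 / 2000000 : ℝ) ≤ besselI 0 (6 / 7) := by
  refine le_trans ?_ (sum_besselITerm_le_besselI (by norm_num) 0 8)
  norm_num [Finset.sum_range_succ, besselITerm, Nat.factorial]

/-- Enclosure `I₁(6/7) ≥ 0.4691534`. [cite: AbramowitzStegun1964, 9.6.10 (the series defining I_ν, summed exactly in ℚ)] -/
private theorem I1a_lo : (2345767 / 5000000 : ℝ) ≤ besselI 1 (6 / 7) := by
  refine le_trans ?_ (sum_besselITerm_le_besselI (by norm_num) 1 8)
  norm_num [Finset.sum_range_succ, besselITerm, Nat.factorial]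

/-- Enclosure `I₂(6/7) ≥ 0.09759`. [cite: AbramowitzStegun1964, 9.6.10 (the series defining I_ν, summed exactly in ℚ)] -/
private theorem I2a_lo : (9759 / 100000 : ℝ) ≤ besselI 2 (6 / 7) := by
  refine le_trans ?_ (sum_besselITerm_le_besselI (by norm_num) 2 8)
  norm_num [Finset.sum_range_succ, besselITerm, Nat.factorial]

/-- Enclosure `I₀(18/7) ≥ 3.4755528`. [cite: AbramowitzStegun1964, 9.6.10 (the series defining I_ν, summed exactly in ℚ)] -/
private theorem I0b_lo : (4344441 / 1250000 : ℝ) ≤ besselI 0 (18 / 7) := by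
  refine le_trans ?_ (sum_besselITerm_le_besselI (by norm_num) 0 8)
  norm_num [Finset.sum_range_succ, besselITerm, Nat.factorial]

/-- Enclosure `I₁(18/7) ≥ 2.6850328`. [cite: AbramowitzStegun1964, 9.6.10 (the series defining I_ν, summed exactly in ℚ)] -/
private theorem I1b_lo : (3356291 / 1250000 : ℝ) ≤ besselI 1 (18 / 7) := by
  refine le_trans ?_ (sum_besselITerm_le_besselI (by norm_num) 1 8)
  norm_num [Finset.sum_range_succ, besselITerm, Nat.factorial]

/-- Enclosure `I₂(18/7) ≥ 1.3871939`. [cite: AbramowitzStegun1964, 9.6.10 (the series defining I_ν, summed exactly in ℚ)] -/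
private theorem I2b_lo : (13871939 / 10000000 : ℝ) ≤ besselI 2 (18 / 7) := by
  refine le_trans ?_ (sum_besselITerm_le_besselI (by norm_num) 2 8)
  norm_num [Finset.sum_range_succ, besselITerm, Nat.factorial]

/-- Enclosure `I₀(6/7) ≤ 1.1922817`. [cite: AbramowitzStegun1964, 9.6.10 (the series defining I_ν, summed exactly in ℚ)] -/
private theorem I0a_hi : besselI 0 (6 / 7) ≤ 93147 / 78125 := by
  refine (besselI_le_sum_add_tail (by norm_num) 0 8 (q := 1 / 441) (by norm_num) (by norm_num)).trans ?_
  norm_num [Finset.sum_range_succ, besselITerm, Nat.factorial]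

/-- Enclosure `I₁(6/7) ≤ 0.4691535`. [cite: AbramowitzStegun1964, 9.6.10 (the series defining I_ν, summed exactly in ℚ)] -/
private theorem I1a_hi : besselI 1 (6 / 7) ≤ 938307 / 2000000 := by
  refine (besselI_le_sum_add_tail (by norm_num) 1 8 (q := 1 / 490) (by norm_num) (by norm_num)).trans ?_
  norm_num [Finset.sum_range_succ, besselITerm, Nat.factorial]

/-- Enclosure `I₂(6/7) ≤ 0.0975901`. [cite: AbramowitzStegun1964, 9.6.10 (the series defining I_ν, summed exactly in ℚ)] -/
private theorem I2a_hi : besselI 2 (6 / 7) ≤ 975901 / 10000000 := by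
  refine (besselI_le_sum_add_tail (by norm_num) 2 8 (q := 1 / 539) (by norm_num) (by norm_num)).trans ?_
  norm_num [Finset.sum_range_succ, besselITerm, Nat.factorial]

/-- Enclosure `I₃(6/7) ≤ 0.0137332`. [cite: AbramowitzStegun1964, 9.6.10 (the series defining I_ν, summed exactly in ℚ)] -/
private theorem I3a_hi : besselI 3 (6 / 7) ≤ 34333 / 2500000 := by
  refine (besselI_le_sum_add_tail (by norm_num) 3 8 (q := 1 / 588) (by norm_num) (by norm_num)).trans ?_
  norm_num [Finset.sum_range_succ, besselITerm, Nat.factorial]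

/-- Enclosure `I₄(6/7) ≤ 0.0014581`. [cite: AbramowitzStegun1964, 9.6.10 (the series defining I_ν, summed exactly in ℚ)] -/
private theorem I4a_hi : besselI 4 (6 / 7) ≤ 14581 / 10000000 := by
  refine (besselI_le_sum_add_tail (by norm_num) 4 8 (q := 1 / 637) (by norm_num) (by norm_num)).trans ?_
  norm_num [Finset.sum_range_succ, besselITerm, Nat.factorial]

/-- Enclosure `I₅(6/7) ≤ 0.0001243`. [cite: AbramowitzStegun1964, 9.6.10 (the series defining I_ν, summed exactly in ℚ)] -/
private theorem I5a_hi : besselI 5 (6 / 7) ≤ 1243 / 10000000 := by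
  refine (besselI_le_sum_add_tail (by norm_num) 5 8 (q := 1 / 686) (by norm_num) (by norm_num)).trans ?_
  norm_num [Finset.sum_range_succ, besselITerm, Nat.factorial]

/-- Enclosure `I₀(18/7) ≤ 3.4755529`. [cite: AbramowitzStegun1964, 9.6.10 (the series defining I_ν, summed exactly in ℚ)] -/
private theorem I0b_hi : besselI 0 (18 / 7) ≤ 34755529 / 10000000 := by
  refine (besselI_le_sum_add_tail (by norm_num) 0 8 (q := 1 / 49) (by norm_num) (by norm_num)).trans ?_
  norm_num [Finset.sum_range_succ, besselITerm, Nat.factorial]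

/-- Enclosure `I₁(18/7) ≤ 2.6850329`. [cite: AbramowitzStegun1964, 9.6.10 (the series defining I_ν, summed exactly in ℚ)] -/
private theorem I1b_hi : besselI 1 (18 / 7) ≤ 26850329 / 10000000 := by
  refine (besselI_le_sum_add_tail (by norm_num) 1 8 (q := 9 / 490) (by norm_num) (by norm_num)).trans ?_
  norm_num [Finset.sum_range_succ, besselITerm, Nat.factorial]

/-- Enclosure `I₂(18/7) ≤ 1.387194`. [cite: AbramowitzStegun1964, 9.6.10 (the series defining I_ν, summed exactly in ℚ)] -/
private theorem I2b_hi : besselI 2 (18 / 7) ≤ 693597 / 500000 := by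
  refine (besselI_le_sum_add_tail (by norm_num) 2 8 (q := 9 / 539) (by norm_num) (by norm_num)).trans ?_
  norm_num [Finset.sum_range_succ, besselITerm, Nat.factorial]

/-- Enclosure `I₃(18/7) ≤ 0.5271757`. [cite: AbramowitzStegun1964, 9.6.10 (the series defining I_ν, summed exactly in ℚ)] -/
private theorem I3b_hi : besselI 3 (18 / 7) ≤ 5271757 / 10000000 := by
  refine (besselI_le_sum_add_tail (by norm_num) 3 8 (q := 3 / 196) (by norm_num) (by norm_num)).trans ?_
  norm_num [Finset.sum_range_succ, besselITerm, Nat.factorial]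

/-- Enclosure `I₄(18/7) ≤ 0.1571176`. [cite: AbramowitzStegun1964, 9.6.10 (the series defining I_ν, summed exactly in ℚ)] -/
private theorem I4b_hi : besselI 4 (18 / 7) ≤ 196397 / 1250000 := by
  refine (besselI_le_sum_add_tail (by norm_num) 4 8 (q := 9 / 637) (by norm_num) (by norm_num)).trans ?_
  norm_num [Finset.sum_range_succ, besselITerm, Nat.factorial]

/-- Enclosure `I₅(18/7) ≤ 0.0383656`. [cite: AbramowitzStegun1964, 9.6.10 (the series defining I_ν, summed exactly in ℚ)] -/
private theorem I5b_hi : besselI 5 (18 / 7) ≤ 47957 / 1250000 := by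
  refine (besselI_le_sum_add_tail (by norm_num) 5 8 (q := 9 / 686) (by norm_num) (by norm_num)).trans ?_
  norm_num [Finset.sum_range_succ, besselITerm, Nat.factorial]

/-! ### The dual sums at `K₀ = 6/7` -/

/-- The denominator: `D = ∑_{k∈ℤ} I_k(6/7) I_k(18/7)² ≥ 21.5423` (the five central terms).
[cite: FrohlichSpencerCMP1982, §2.3 (duality transformation)] -/
private theorem den_six_sevenths_ge :
    (21.5423 : ℝ) ≤ ∑' k : ℤ, besselI k (6 / 7) * besselI k (3 * (6 / 7)) ^ 2 := by
  have hK : (0 : ℝ) ≤ 6 / 7 := by norm_num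
  have hx : (3 * (6 / 7) : ℝ) = 18 / 7 := by norm_num
  rw [hx]
  have hs : Summable fun k : ℤ => besselI k (6 / 7) * besselI k (18 / 7) ^ 2 := by
    have := summable_wiredPair_den hK 3; push_cast at this; rw [hx] at this; exact this
  have hnn : ∀ k : ℤ, 0 ≤ besselI k (6 / 7) * besselI k (18 / 7) ^ 2 := fun k =>
    mul_nonneg (besselI_nonneg hK k) (sq_nonneg _)
  have hsum := hs.sum_le_tsum ({0, 1, -1, 2, -2} : Finset ℤ) (fun k _ => hnn k)
  refine le_trans ?_ hsum
  rw [Finset.sum_insert (by decide), Finset.sum_insert (by decide), Finset.sum_insert (by decide),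
    Finset.sum_pair (by decide)]
  simp only [besselI_neg_index]
  have h0 : (2384563 / 2000000 : ℝ) * (4344441 / 1250000) ^ 2 ≤ besselI 0 (6 / 7) * besselI 0 (18 / 7) ^ 2 :=
    mul_le_mul I0a_lo (pow_le_pow_left₀ (by norm_num) I0b_lo 2) (by norm_num) (besselI_nonneg hK 0)
  have h1 : (2345767 / 5000000 : ℝ) * (3356291 / 1250000) ^ 2 ≤ besselI 1 (6 / 7) * besselI 1 (18 / 7) ^ 2 :=
    mul_le_mul I1a_lo (pow_le_pow_left₀ (by norm_num) I1b_lo 2) (by norm_num) (besselI_nonneg hK 1)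
  have h2 : (9759 / 100000 : ℝ) * (13871939 / 10000000) ^ 2 ≤ besselI 2 (6 / 7) * besselI 2 (18 / 7) ^ 2 :=
    mul_le_mul I2a_lo (pow_le_pow_left₀ (by norm_num) I2b_lo 2) (by norm_num) (besselI_nonneg hK 2)
  nlinarith [h0, h1, h2]

/-- Factorial domination of the dual correlation terms: for `j ≥ 0`,
`I_j(K) I_{j+1}(mK)² ≤ I_0(K) I_0(mK)² (K/2)^j/j!` and `I_{j+1}(K) I_j(mK)² ≤ I_0(K) I_0(mK)² (K/2)^j/j!`.
[cite: AbramowitzStegun1964, 9.6.10 (the series defining I_ν)] -/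
private theorem num_term_le {K : ℝ} (hK : 0 ≤ K) {y : ℝ} (hy : 0 ≤ y) (j : ℕ) :
    besselI j K * besselI (j + 1) y ^ 2 ≤ besselI 0 K * besselI 0 y ^ 2 * ((K / 2) ^ j / j !) ∧
    besselI (j + 1) K * besselI j y ^ 2 ≤ besselI 0 K * besselI 0 y ^ 2 * ((K / 2) ^ j / j !) := by
  have hj : besselI j K ≤ (K / 2) ^ j / j ! * besselI 0 K := besselI_natCast_le_pow_div_factorial_mul hK j
  have hj1 : besselI (j + 1 : ℕ) K ≤ besselI j K := besselI_natCast_succ_le_self hK j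
  have hsq : ∀ n : ℤ, besselI n y ^ 2 ≤ besselI 0 y ^ 2 := fun n =>
    pow_le_pow_left₀ (besselI_nonneg hy n) (besselI_le_besselI_zero hy n) 2
  have h0K : 0 ≤ besselI 0 K := besselI_nonneg hK 0
  have hfac : 0 ≤ (K / 2) ^ j / j ! := by positivity
  constructor
  · calc besselI j K * besselI (j + 1) y ^ 2 ≤ ((K / 2) ^ j / j ! * besselI 0 K) * besselI 0 y ^ 2 :=
          mul_le_mul hj (hsq _) (sq_nonneg _) (mul_nonneg hfac h0K)
      _ = besselI 0 K * besselI 0 y ^ 2 * ((K / 2) ^ j / j !) := by ring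
  · have hj' : besselI (j + 1) K ≤ (K / 2) ^ j / j ! * besselI 0 K := by
      have := hj1.trans hj
      exact_mod_cast this
    calc besselI (j + 1) K * besselI j y ^ 2 ≤ ((K / 2) ^ j / j ! * besselI 0 K) * besselI 0 y ^ 2 :=
          mul_le_mul hj' (hsq _) (sq_nonneg _) (mul_nonneg hfac h0K)
      _ = besselI 0 K * besselI 0 y ^ 2 * ((K / 2) ^ j / j !) := by ring

/-- The factorial tail: `∑_{j ≥ 0} (K/2)^{j+5}/(j+5)! ≤ ((K/2)⁵/5!)/(1 − K/12)` for `0 ≤ K < 12`.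
[cite: AbramowitzStegun1964, 9.6.10 (the series defining I_ν)] -/
private theorem factorial_tail_le {K : ℝ} (hK : 0 ≤ K) (hK12 : K < 12) :
    (Summable fun j : ℕ => (K / 2) ^ (j + 5) / (j + 5)!) ∧
    (∑' j : ℕ, (K / 2) ^ (j + 5) / (j + 5)!) ≤ ((K / 2) ^ 5 / 5 !) / (1 - K / 12) := by
  have hq0 : 0 ≤ K / 12 := by positivity
  have hq1 : K / 12 < 1 := by rw [div_lt_one (by norm_num)]; exact hK12
  have h := summable_and_tsum_le_of_succ_le_mul (a := fun j : ℕ => (K / 2) ^ (j + 5) / (j + 5)!)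
    (fun j => by positivity) hq0 hq1 (fun j => ?_)
  · simpa using h
  · -- ratio `(K/2)/(j+6) ≤ K/12`
    have hf : ((j + 1 + 5)! : ℝ) = (j + 6 : ℝ) * ((j + 5)! : ℝ) := by
      rw [show j + 1 + 5 = (j + 5) + 1 by ring, Nat.factorial_succ]; push_cast; ring
    rw [hf, show j + 1 + 5 = (j + 5) + 1 by ring, pow_succ]
    have hpos : (0 : ℝ) < (j + 5)! := by positivity
    have hj6 : (6 : ℝ) ≤ j + 6 := by linarith [Nat.cast_nonneg (α := ℝ) j]
    rw [div_le_iff₀ (by positivity)]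
    calc (K / 2) ^ (j + 5) * (K / 2) = K / 12 * ((K / 2) ^ (j + 5) / (j + 5)!) * (6 * (j + 5)!) := by
          field_simp; ring
      _ ≤ K / 12 * ((K / 2) ^ (j + 5) / (j + 5)!) * ((j + 6 : ℝ) * (j + 5)!) := by
          apply mul_le_mul_of_nonneg_left _ (by positivity)
          exact mul_le_mul_of_nonneg_right hj6 hpos.le

/-- One-sided tail of the dual correlation sum: for a sequence dominated by the factorial terms from
index `5` on, `∑_{j ≥ 0} u_{j+5} ≤ C · ((K/2)⁵/5!)/(1 − K/12)`. [cite: AbramowitzStegun1964, 9.6.10 (the series defining I_ν)] -/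
private theorem tail_le_of_dominated {K C : ℝ} (hK : 0 ≤ K) (hK12 : K < 12) (hC : 0 ≤ C) {u : ℕ → ℝ}
    (hu0 : ∀ j, 0 ≤ u j) (hu : ∀ j, u j ≤ C * ((K / 2) ^ j / j !)) :
    (Summable fun j => u (j + 5)) ∧ (∑' j, u (j + 5)) ≤ C * (((K / 2) ^ 5 / 5 !) / (1 - K / 12)) := by
  obtain ⟨hs, ht⟩ := factorial_tail_le hK hK12
  have hdom : ∀ j, u (j + 5) ≤ C * ((K / 2) ^ (j + 5) / (j + 5)!) := fun j => by
    exact_mod_cast hu (j + 5)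
  have hs' : Summable fun j => C * ((K / 2) ^ (j + 5) / (j + 5)!) := hs.mul_left C
  have hsu : Summable fun j => u (j + 5) := Summable.of_nonneg_of_le (fun j => hu0 _) hdom hs'
  refine ⟨hsu, ?_⟩
  calc ∑' j, u (j + 5) ≤ ∑' j, C * ((K / 2) ^ (j + 5) / (j + 5)!) := hsu.tsum_le_tsum hdom hs'
    _ = C * ∑' j, (K / 2) ^ (j + 5) / (j + 5)! := tsum_mul_left
    _ ≤ C * (((K / 2) ^ 5 / 5 !) / (1 - K / 12)) := mul_le_mul_of_nonneg_left ht hC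

/-- The non-negative-order half of the dual correlation sum at `K₀ = 6/7`:
`u_j = I_j(6/7) I_{j+1}(18/7)²`. [cite: FrohlichSpencerCMP1982, §2.3 (duality transformation)] -/
private def uSeq (j : ℕ) : ℝ := besselI (j : ℤ) (6 / 7) * besselI ((j : ℤ) + 1) (18 / 7) ^ 2

/-- The negative-order half of the dual correlation sum at `K₀ = 6/7` (orders reflected):
`v_j = I_{j+1}(6/7) I_j(18/7)²`. [cite: FrohlichSpencerCMP1982, §2.3 (duality transformation)] -/
private def vSeq (j : ℕ) : ℝ := besselI ((j : ℤ) + 1) (6 / 7) * besselI (j : ℤ) (18 / 7) ^ 2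

/-- The dual correlation family at `K₀ = 6/7` is summable over `ℤ`. [cite: FrohlichSpencerCMP1982, §2.3 (duality transformation)] -/
private theorem summable_num_six_sevenths :
    Summable fun k : ℤ => besselI k (6 / 7) * besselI (k + 1) (18 / 7) ^ 2 := by
  have h := summable_wiredPair_num (by norm_num : (0 : ℝ) ≤ 6 / 7) 3
  have hx : ((3 : ℕ) : ℝ) * (6 / 7) = 18 / 7 := by norm_num
  rw [hx] at h
  exact h

/-- `u` is summable. [cite: FrohlichSpencerCMP1982, §2.3 (duality transformation)] -/
private theorem summable_uSeq : Summable uSeq :=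
  summable_num_six_sevenths.comp_injective Nat.cast_injective

/-- The reflected negative-order terms are the `v_j`. [cite: AbramowitzStegun1964, 9.6.6] -/
private theorem neg_term_eq_vSeq (j : ℕ) :
    besselI (-((j : ℤ) + 1)) (6 / 7) * besselI (-((j : ℤ) + 1) + 1) (18 / 7) ^ 2 = vSeq j := by
  rw [vSeq, besselI_neg_index, show -((j : ℤ) + 1) + 1 = -(j : ℤ) by ring, besselI_neg_index]

/-- The negative-order half is summable. [cite: FrohlichSpencerCMP1982, §2.3 (duality transformation)] -/
private theorem summable_neg_six_sevenths :
    Summable fun j : ℕ => besselI (-((j : ℤ) + 1)) (6 / 7) * besselI (-((j : ℤ) + 1) + 1) (18 / 7) ^ 2 := by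
  have hneg_inj : Function.Injective fun j : ℕ => -((j : ℤ) + 1) := by
    intro a b h
    have h' : (a : ℤ) + 1 = (b : ℤ) + 1 := neg_injective h
    exact_mod_cast add_right_cancel h'
  exact summable_num_six_sevenths.comp_injective hneg_inj

/-- `v` is summable. [cite: FrohlichSpencerCMP1982, §2.3 (duality transformation)] -/
private theorem summable_vSeq : Summable vSeq :=
  summable_neg_six_sevenths.congr neg_term_eq_vSeq

/-- Splitting the dual correlation sum over `ℤ` into its two halves. [cite: FrohlichSpencerCMP1982, §2.3 (duality transformation)] -/
private theorem num_eq_tsum_uSeq_add_tsum_vSeq :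
    ∑' k : ℤ, besselI k (6 / 7) * besselI (k + 1) (3 * (6 / 7)) ^ 2 =
      (∑' j, uSeq j) + ∑' j, vSeq j := by
  have hx : (3 * (6 / 7) : ℝ) = 18 / 7 := by norm_num
  rw [hx, tsum_of_nat_of_neg_add_one
    (f := fun k : ℤ => besselI k (6 / 7) * besselI (k + 1) (18 / 7) ^ 2) summable_uSeq
    summable_neg_six_sevenths]
  exact congrArg₂ (· + ·) rfl (tsum_congr neg_term_eq_vSeq)

/-- Monotone products of enclosures. [folklore] -/
private theorem mul_sq_le_mul_sq {a b c d : ℝ} (ha : 0 ≤ a) (hab : a ≤ b) (hc : 0 ≤ c) (hcd : c ≤ d) :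
    a * c ^ 2 ≤ b * d ^ 2 :=
  mul_le_mul hab (pow_le_pow_left₀ hc hcd 2) (sq_nonneg _) (ha.trans hab)

/-- The first five `u_j`, enclosed. [cite: AbramowitzStegun1964, 9.6.10 (the series defining I_ν)] -/
private theorem sum_uSeq_le :
    uSeq 0 + uSeq 1 + uSeq 2 + uSeq 3 + uSeq 4 ≤ 9.5259 := by
  have hK : (0 : ℝ) ≤ 6 / 7 := by norm_num
  have hy : (0 : ℝ) ≤ 18 / 7 := by norm_num
  have u0 : uSeq 0 ≤ 93147 / 78125 * (26850329 / 10000000) ^ 2 :=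
    mul_sq_le_mul_sq (besselI_nonneg hK 0) I0a_hi (besselI_nonneg hy 1) I1b_hi
  have u1 : uSeq 1 ≤ 938307 / 2000000 * (693597 / 500000) ^ 2 :=
    mul_sq_le_mul_sq (besselI_nonneg hK 1) I1a_hi (besselI_nonneg hy 2) I2b_hi
  have u2 : uSeq 2 ≤ 975901 / 10000000 * (5271757 / 10000000) ^ 2 :=
    mul_sq_le_mul_sq (besselI_nonneg hK 2) I2a_hi (besselI_nonneg hy 3) I3b_hi
  have u3 : uSeq 3 ≤ 34333 / 2500000 * (196397 / 1250000) ^ 2 :=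
    mul_sq_le_mul_sq (besselI_nonneg hK 3) I3a_hi (besselI_nonneg hy 4) I4b_hi
  have u4 : uSeq 4 ≤ 14581 / 10000000 * (47957 / 1250000) ^ 2 :=
    mul_sq_le_mul_sq (besselI_nonneg hK 4) I4a_hi (besselI_nonneg hy 5) I5b_hi
  norm_num at u0 u1 u2 u3 u4 ⊢
  linarith

/-- The first five `v_j`, enclosed. [cite: AbramowitzStegun1964, 9.6.10 (the series defining I_ν)] -/
private theorem sum_vSeq_le :
    vSeq 0 + vSeq 1 + vSeq 2 + vSeq 3 + vSeq 4 ≤ 6.39753 := by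
  have hK : (0 : ℝ) ≤ 6 / 7 := by norm_num
  have hy : (0 : ℝ) ≤ 18 / 7 := by norm_num
  have v0 : vSeq 0 ≤ 938307 / 2000000 * (34755529 / 10000000) ^ 2 :=
    mul_sq_le_mul_sq (besselI_nonneg hK 1) I1a_hi (besselI_nonneg hy 0) I0b_hi
  have v1 : vSeq 1 ≤ 975901 / 10000000 * (26850329 / 10000000) ^ 2 :=
    mul_sq_le_mul_sq (besselI_nonneg hK 2) I2a_hi (besselI_nonneg hy 1) I1b_hi
  have v2 : vSeq 2 ≤ 34333 / 2500000 * (693597 / 500000) ^ 2 :=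
    mul_sq_le_mul_sq (besselI_nonneg hK 3) I3a_hi (besselI_nonneg hy 2) I2b_hi
  have v3 : vSeq 3 ≤ 14581 / 10000000 * (5271757 / 10000000) ^ 2 :=
    mul_sq_le_mul_sq (besselI_nonneg hK 4) I4a_hi (besselI_nonneg hy 3) I3b_hi
  have v4 : vSeq 4 ≤ 1243 / 10000000 * (196397 / 1250000) ^ 2 :=
    mul_sq_le_mul_sq (besselI_nonneg hK 5) I5a_hi (besselI_nonneg hy 4) I4b_hi
  norm_num at v0 v1 v2 v3 v4 ⊢
  linarith

/-- The tails `∑_{j ≥ 5} u_j`, `∑_{j ≥ 5} v_j ≤ 0.001869` (factorial domination).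
[cite: AbramowitzStegun1964, 9.6.10 (the series defining I_ν)] -/
private theorem tail_uSeq_vSeq_le :
    (Summable fun j => uSeq (j + 5)) ∧ (∑' j, uSeq (j + 5)) ≤ 0.00187 ∧
    (Summable fun j => vSeq (j + 5)) ∧ (∑' j, vSeq (j + 5)) ≤ 0.00187 := by
  have hK : (0 : ℝ) ≤ 6 / 7 := by norm_num
  have hy : (0 : ℝ) ≤ 18 / 7 := by norm_num
  set C : ℝ := besselI 0 (6 / 7) * besselI 0 (18 / 7) ^ 2 with hC
  have hC0 : 0 ≤ C := mul_nonneg (besselI_nonneg hK 0) (sq_nonneg _)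
  have hu0 : ∀ j, 0 ≤ uSeq j := fun j => mul_nonneg (besselI_nonneg hK _) (sq_nonneg _)
  have hv0 : ∀ j, 0 ≤ vSeq j := fun j => mul_nonneg (besselI_nonneg hK _) (sq_nonneg _)
  have hudom : ∀ j, uSeq j ≤ C * (((6 / 7 : ℝ) / 2) ^ j / j !) := fun j => by
    have h := (num_term_le hK hy j).1
    rw [uSeq, hC]
    exact_mod_cast h
  have hvdom : ∀ j, vSeq j ≤ C * (((6 / 7 : ℝ) / 2) ^ j / j !) := fun j => by
    have h := (num_term_le hK hy j).2
    rw [vSeq, hC]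
    exact_mod_cast h
  obtain ⟨hsu5, htu⟩ := tail_le_of_dominated hK (by norm_num) hC0 hu0 hudom
  obtain ⟨hsv5, htv⟩ := tail_le_of_dominated hK (by norm_num) hC0 hv0 hvdom
  have hCle : C ≤ 93147 / 78125 * (34755529 / 10000000) ^ 2 :=
    mul_sq_le_mul_sq (besselI_nonneg hK 0) I0a_hi (besselI_nonneg hy 0) I0b_hi
  have hfac : ((((6 / 7 : ℝ) / 2) ^ 5 / 5 !) / (1 - 6 / 7 / 12)) ≤ 0.0001298 := by
    norm_num [Nat.factorial]
  have htail : C * ((((6 / 7 : ℝ) / 2) ^ 5 / 5 !) / (1 - 6 / 7 / 12)) ≤ 0.00187 := by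
    calc C * ((((6 / 7 : ℝ) / 2) ^ 5 / 5 !) / (1 - 6 / 7 / 12))
        ≤ (93147 / 78125 * (34755529 / 10000000) ^ 2) * 0.0001298 :=
          mul_le_mul hCle hfac (by positivity) (by norm_num)
      _ ≤ 0.00187 := by norm_num
  exact ⟨hsu5, htu.trans htail, hsv5, htv.trans htail⟩

/-- The numerator: `N = ∑_{k∈ℤ} I_k(6/7) I_{k+1}(18/7)² ≤ 15.9273` (ten explicit dual terms, the rest
dominated by `2 I_0(6/7) I_0(18/7)² ∑_{j≥5} (3/7)^j/j!`). [cite: FrohlichSpencerCMP1982, §2.3 (duality transformation)] -/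
private theorem num_six_sevenths_le :
    ∑' k : ℤ, besselI k (6 / 7) * besselI (k + 1) (3 * (6 / 7)) ^ 2 ≤ (15.9273 : ℝ) := by
  obtain ⟨_, htu, _, htv⟩ := tail_uSeq_vSeq_le
  rw [num_eq_tsum_uSeq_add_tsum_vSeq, ← summable_uSeq.sum_add_tsum_nat_add 5,
    ← summable_vSeq.sum_add_tsum_nat_add 5]
  simp only [Finset.sum_range_succ, Finset.sum_range_zero, zero_add]
  have hu := sum_uSeq_le
  have hv := sum_vSeq_le
  linarith

/-- **The certified decimal `(6/7)·E^{wired}_3(6/7) < 2/π`** (dual sums: `N ≤ 15.9273`, `D ≥ 21.5423`,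
`(6/7)·N/D ≤ 0.63373 < 2/3.1416 < 2/π`; float value `0.6334` against `2/π = 0.63662`). The input of
`kt_le_of_stableBelow_of_wiredCeiling` at `K₀ = 6/7`. [cite: Ginibre1970, Model 3 p. 322 (plane rotators with ferromagnetic pair couplings); Nelson2002Defects, §2.2.2 eqs. (2.44)–(2.47) (the threshold 2/π)] -/
theorem six_sevenths_mul_wiredPairEnergy_lt [MeasurableSpace Circle] [BorelSpace Circle] :
    (6 / 7 : ℝ) * wiredPairEnergy (6 / 7) 3 < 2 / Real.pi := by
  rw [wiredPairEnergy_eq_tsum_div_tsum]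
  push_cast
  have hD := den_six_sevenths_ge
  have hN := num_six_sevenths_le
  have hDpos : 0 < ∑' k : ℤ, besselI k (6 / 7) * besselI k (3 * (6 / 7)) ^ 2 :=
    lt_of_lt_of_le (by norm_num) hD
  have hratio : (∑' k : ℤ, besselI k (6 / 7) * besselI (k + 1) (3 * (6 / 7)) ^ 2) /
      (∑' k : ℤ, besselI k (6 / 7) * besselI k (3 * (6 / 7)) ^ 2) ≤ 15.9273 / 21.5423 :=
    div_le_div₀ (by norm_num) hN (by norm_num) hD
  have hπ : 2 / (3.1416 : ℝ) < 2 / Real.pi :=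
    div_lt_div_of_pos_left (by norm_num) Real.pi_pos Real.pi_lt_d4
  refine lt_trans ?_ hπ
  calc (6 / 7 : ℝ) * ((∑' k : ℤ, besselI k (6 / 7) * besselI (k + 1) (3 * (6 / 7)) ^ 2) /
        (∑' k : ℤ, besselI k (6 / 7) * besselI k (3 * (6 / 7)) ^ 2))
      ≤ 6 / 7 * (15.9273 / 21.5423) := mul_le_mul_of_nonneg_left hratio (by norm_num)
    _ < 2 / 3.1416 := by norm_num

end Decimal

/-! ## §5 The Kosterlitz–Thouless reading of the wired ceiling: `T_c ≤ (7/6)·J` -/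

section KosterlitzThouless

open Literature.MathematicalPhysics.StatisticalMechanics.KosterlitzThouless

variable [MeasurableSpace Circle] [BorelSpace Circle]

/-- **`T_c ≤ (7/6)·J` from the wired ceiling.** Let `ρ` obey the Kosterlitz–Thouless stability inequality
`StableBelow ρ T_c` (the RG HYPOTHESIS, Nelson 2002 §2.2.2) with `T_c > 0`, and be dominated on `(0, T_c)`
by the wired ceiling `ρ(T) ≤ J·E^{wired}_3(J/T)` of the XY model with coupling `J > 0` (as every limit
of finite-volume helicity moduli is). Then **`T_c ≤ (7/6)·J ≈ 1.1667·J`** — against `1.3448·J` from the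
Ward energy ceiling (`kt_le_of_stableBelow_of_energyCeiling_decimal`) and `(π/2)·J` bare; the float
optimum of the wired route is `J/0.8603 = 1.1624·J`, Monte Carlo `0.893·J` [floats, not used].
[cite: Nelson2002Defects, §2.2.2 eqs. (2.44)–(2.47) (stability inequality, consumed as hypothesis); Ginibre1970, Model 3 p. 322] -/
theorem kt_le_seven_sixths_of_stableBelow_of_wiredCeiling {ρ : ℝ → ℝ} {Tc J : ℝ} (hJ : 0 < J)
    (hTc : 0 < Tc) (hst : StableBelow ρ Tc)
    (hceil : ∀ ⦃T : ℝ⦄, 0 < T → T < Tc → ρ T ≤ J * wiredPairEnergy (J / T) 3) :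
    Tc ≤ 7 / 6 * J := by
  have h := kt_le_of_stableBelow_of_wiredCeiling hJ hTc (by norm_num : (0 : ℝ) < 6 / 7) hst hceil
    six_sevenths_mul_wiredPairEnergy_lt
  calc Tc ≤ J / (6 / 7) := h
    _ = 7 / 6 * J := by ring

/-- **The bound from finite-volume helicity moduli**: `StableBelow ρ T_c` and
`ρ(T) = lim_n T·βΥ_{L_n}(J/T)` on `(0, T_c)` (tori `(ℤ/L_nℤ)²`, `L_n ≥ 3`, any sequence) give
**`T_c ≤ (7/6)·J`**. [cite: Nelson2002Defects, §2.2.2 eqs. (2.44)–(2.47) (stability inequality, consumed as hypothesis); FisherBarberJasnow1973, §II] -/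
theorem kt_le_seven_sixths_of_stableBelow_of_tendsto_torusXYStiffness {ρ : ℝ → ℝ} {Tc J : ℝ}
    (hJ : 0 < J) (hTc : 0 < Tc) (hst : StableBelow ρ Tc)
    (Ls : ℕ → ℕ) [∀ n, NeZero (Ls n)] (hLs : ∀ n, 3 ≤ Ls n)
    (hlim : ∀ ⦃T : ℝ⦄, 0 < T → T < Tc →
      Tendsto (fun n => T * torusXYStiffness (Ls n) (J / T)) atTop (𝓝 (ρ T))) :
    Tc ≤ 7 / 6 * J := by
  have h := kt_le_of_stableBelow_of_tendsto_torusXYStiffness_wired hJ hTc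
    (by norm_num : (0 : ℝ) < 6 / 7) hst Ls hLs hlim six_sevenths_mul_wiredPairEnergy_lt
  calc Tc ≤ J / (6 / 7) := h
    _ = 7 / 6 * J := by ring

/-- The finite-volume stiffness ceiling at the certified point: **`βΥ_L(6/7) < 2/π`** for every `L ≥ 3` —
at `T = (7/6)·J` the finite-volume helicity modulus of every torus is already below the universal-jump
value `(2/π)·T`. [cite: FisherBarberJasnow1973, §II eqs. (2.4)–(2.5); Nelson2002Defects, §2.2.2 eq. (2.47)] -/
theorem torusXYStiffness_six_sevenths_lt {L : ℕ} [NeZero L] (hL : 3 ≤ L) :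
    torusXYStiffness L (6 / 7) < 2 / Real.pi :=
  (torusXYStiffness_le_mul_wiredPairEnergy hL (by norm_num)).trans_lt six_sevenths_mul_wiredPairEnergy_lt

end KosterlitzThouless

end Literature.Probability.LatticeModels
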